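import Mathlib
import Literature.AlgebraicGeometry.Resolution.CobordantGame

/-!
# `WeightedInvariant.LocalWeightedDrop`: the ORBIT LEMMA at an exceptional point and the slice pull-back

Route `ResolutionOfSingularities/WeightedInvariant`, crux `LocalWeightedDrop`
(stmt-ResolutionOfSingularities-8899).  [OURS · L1 W4.3] — §1 «orbit lemma» (A1 = B1
`orbit_quasi_invariance`) and §5 R3-T1 (`wildSlice_pullback`) of ideator res-L1-w43-idea-1's
`Sketch-L1-idea-1.lean` v3 (sha16 `631198685223c190`, round 3), with the four substitution families
`orbitL`, `orbitR`, `sliceL`, `sliceR` landed VERBATIM and the two theorems PROVED with the sketch's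
signatures verbatim.  Companion of `…Theorems.GradedGame` (`WeightedInvariantLocalWeightedDropGradedGame`,
the §5 graded-game module).  Nothing here is a statement of the manuscript under review on ladder
RESOLUTION; no new mathematics beyond the sketch (elementary quasi-homogeneity bookkeeping).

Setting (crux `LocalWeightedDrop`): `F ∈ k[[x₁..xₙ]]`, move weights `w`, exceptional point `c` of the
cobordant chart `CobordantGame.cruxChart w c : xᵢ ↦ s^{wᵢ}(cᵢ + yᵢ)` (`wᵢ > 0`), `xᵢ ↦ yᵢ` (`wᵢ = 0`),
successor `g ∈ k[[s, y₁..yₙ]]` with `F(chart_c) = sᵃ·g`.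

**Results (sorry-free).**
* `GradedGame.subst_eq_mul_subst_of_chart_factor` — the one computation behind both statements: if two
  substitutable families `σL`, `σR` on `k[[s, y]]` AGREE on every chart component
  (`(chart_c)ᵢ(σL) = (chart_c)ᵢ(σR)`), and `σR(s) = u·σL(s)` with `σL(s) ≠ 0`, then from
  `F(chart_c) = sᵃ·g` one gets `g(σL) = uᵃ·g(σR)` (substitution is a ring morphism composing correctly,
  `MvPowerSeries.subst_comp_subst_apply`; cancel `σL(s)ᵃ` in the domain `k[[…]]`).
* `GradedGame.orbit_quasi_invariance` (A1 = B1) — `g(s, λ^w(c+y) − c) = λᵃ · g(λ s, y)`, `λ = 1 + μ`: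
  the old torus `𝔾ₘ` read at `c` (the two families `orbitL`/`orbitR` agree on the chart since
  `s^{wᵢ}·λ^{wᵢ}(cᵢ+yᵢ) = (λs)^{wᵢ}(cᵢ+yᵢ)`).
* `GradedGame.wildSlice_pullback` (R3-T1) — the same identity with the slice variable `y_{i₀}` frozen at
  the point: `g(s, sliceL) = (1+μ)ᵃ · g((1+μ)s, y_{≠i₀}, 0)`.
-/

set_option linter.dupNamespace false -- mandated namespace of this single-conjunct summit
set_option autoImplicit false

namespace Summit.ResolutionOfSingularities.ResolutionOfSingularities.Theorems

namespace GradedGame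

open MvPowerSeries
open Literature.AlgebraicGeometry.Resolution

variable {k : Type} [Field k]

/-! ## The four substitution families (verbatim from the sketch, §1 and §5) -/

/-- Left substitution of the orbit identity on `k[[s, y₁..yₙ]] → k[[s, y₁..yₙ, μ]]` (`μ = X (Fin.last (n+1))`):
`s ↦ s`, `yᵢ ↦ (1+μ)^{wᵢ} (cᵢ + yᵢ) − cᵢ`. [OURS · L1 W4.3, Sketch-L1-idea-1 v3 §1] -/
noncomputable def orbitL {n : ℕ} (w : Fin n → ℕ) (c : Fin n → k) : Fin (n + 1) → MvPowerSeries (Fin (n + 2)) k :=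
  Matrix.vecCons (X (0 : Fin (n + 2)))
    (fun i : Fin n => (1 + X (Fin.last (n + 1))) ^ (w i) * (C (c i) + X (Fin.castSucc i.succ)) - C (c i))

/-- Right substitution of the orbit identity: `s ↦ (1+μ) s`, `yᵢ ↦ yᵢ`. [OURS · L1 W4.3, Sketch-L1-idea-1 v3 §1] -/
noncomputable def orbitR {n : ℕ} : Fin (n + 1) → MvPowerSeries (Fin (n + 2)) k :=
  Matrix.vecCons ((1 + X (Fin.last (n + 1))) * X (0 : Fin (n + 2))) (fun i : Fin n => X (Fin.castSucc i.succ))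

/-- `orbitL` with the slice variable `y_{i₀}` FROZEN at the point: `s ↦ s`, `yⱼ ↦ (1+μ)^{wⱼ}(cⱼ+yⱼ) − cⱼ` (`j ≠ i₀`),
`y_{i₀} ↦ c_{i₀}((1+μ)^{w_{i₀}} − 1)`: the orbit of the old torus through the slice `{y_{i₀} = 0}`, re-parametrised by `μ`.
[OURS · L1 W4.3, Sketch-L1-idea-1 v3 §5] -/
noncomputable def sliceL {n : ℕ} (w : Fin n → ℕ) (c : Fin n → k) (i₀ : Fin n) :
    Fin (n + 1) → MvPowerSeries (Fin (n + 2)) k :=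
  Matrix.vecCons (X (0 : Fin (n + 2)))
    (fun i : Fin n => if i = i₀ then (1 + X (Fin.last (n + 1))) ^ (w i) * C (c i) - C (c i)
      else (1 + X (Fin.last (n + 1))) ^ (w i) * (C (c i) + X (Fin.castSucc i.succ)) - C (c i))

/-- `orbitR` followed by restriction to the slice: `s ↦ (1+μ)·s`, `yⱼ ↦ yⱼ` (`j ≠ i₀`), `y_{i₀} ↦ 0`.
[OURS · L1 W4.3, Sketch-L1-idea-1 v3 §5] -/
noncomputable def sliceR {n : ℕ} (i₀ : Fin n) : Fin (n + 1) → MvPowerSeries (Fin (n + 2)) k :=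
  Matrix.vecCons ((1 + X (Fin.last (n + 1))) * X (0 : Fin (n + 2)))
    (fun i : Fin n => if i = i₀ then 0 else X (Fin.castSucc i.succ))

/-! ## Substitutability -/

/-- The crux's chart family has zero constant terms, hence is substitutable. [OURS · L1 W4.3] -/
theorem hasSubst_cruxChart {n : ℕ} (w : Fin n → ℕ) (c : Fin n → k) :
    HasSubst (CobordantGame.cruxChart k w c) :=
  hasSubst_of_constantCoeff_zero fun i => by
    unfold CobordantGame.cruxChart
    by_cases h : 0 < w i
    · rw [if_pos h]
      have hw : w i ≠ 0 := Nat.pos_iff_ne_zero.mp h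
      simp [constantCoeff_X, zero_pow hw]
    · rw [if_neg h]
      simp [constantCoeff_X]

/-- `orbitL` is substitutable (zero constant terms). [OURS · L1 W4.3] -/
theorem hasSubst_orbitL {n : ℕ} (w : Fin n → ℕ) (c : Fin n → k) : HasSubst (orbitL w c) :=
  hasSubst_of_constantCoeff_zero fun j => by
    refine Fin.cases ?_ (fun i => ?_) j
    · simp [orbitL, constantCoeff_X]
    · simp [orbitL, constantCoeff_X]

/-- `orbitR` is substitutable (zero constant terms). [OURS · L1 W4.3] -/
theorem hasSubst_orbitR {n : ℕ} : HasSubst (orbitR (k := k) (n := n)) :=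
  hasSubst_of_constantCoeff_zero fun j => by
    refine Fin.cases ?_ (fun i => ?_) j
    · simp [orbitR, constantCoeff_X]
    · simp [orbitR, constantCoeff_X]

/-- `sliceL` is substitutable (zero constant terms). [OURS · L1 W4.3] -/
theorem hasSubst_sliceL {n : ℕ} (w : Fin n → ℕ) (c : Fin n → k) (i₀ : Fin n) : HasSubst (sliceL w c i₀) :=
  hasSubst_of_constantCoeff_zero fun j => by
    refine Fin.cases ?_ (fun i => ?_) j
    · simp [sliceL, constantCoeff_X]
    · by_cases h : i = i₀
      · simp [sliceL, h, constantCoeff_X]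
      · simp [sliceL, h, constantCoeff_X]

/-- `sliceR` is substitutable (zero constant terms). [OURS · L1 W4.3] -/
theorem hasSubst_sliceR {n : ℕ} (i₀ : Fin n) : HasSubst (sliceR (k := k) i₀) :=
  hasSubst_of_constantCoeff_zero fun j => by
    refine Fin.cases ?_ (fun i => ?_) j
    · simp [sliceR, constantCoeff_X]
    · by_cases h : i = i₀
      · simp [sliceR, h]
      · simp [sliceR, h, constantCoeff_X]

/-! ## The generic cancellation lemma -/

/-- THE COMPUTATION BEHIND THE ORBIT LEMMA.  Two substitutable families `σL`, `σR` on `k[[s, y₁..yₙ]]` that agree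
on every component of the chart `chart_c` (`(chart_c)ᵢ(σL) = (chart_c)ᵢ(σR)`), with `σR(s) = u · σL(s)` and
`σL(s) ≠ 0`: if `F(chart_c) = sᵃ · g` then `g(σL) = uᵃ · g(σR)`.  (Both sides of `F(chart_c)(σL) = F(chart_c)(σR)`
are `σL(s)ᵃ · g(σL)` and `uᵃ σL(s)ᵃ · g(σR)`; cancel `σL(s)ᵃ` in the domain `k[[…]]`.) [OURS · L1 W4.3] -/
theorem subst_eq_mul_subst_of_chart_factor {n : ℕ} {τ : Type} (w : Fin n → ℕ) (c : Fin n → k)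
    {σL σR : Fin (n + 1) → MvPowerSeries τ k} (hL : HasSubst σL) (hR : HasSubst σR)
    (u : MvPowerSeries τ k) (hu : σR 0 = u * σL 0) (h0 : σL 0 ≠ 0)
    (hagree : ∀ i, subst σL (CobordantGame.cruxChart k w c i) = subst σR (CobordantGame.cruxChart k w c i))
    (F : MvPowerSeries (Fin n) k) (a : ℕ) (g : MvPowerSeries (Fin (n + 1)) k)
    (h : subst (CobordantGame.cruxChart k w c) F = X (0 : Fin (n + 1)) ^ a * g) :
    subst σL g = u ^ a * subst σR g := by
  have hc := hasSubst_cruxChart (k := k) w c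
  have e1 : subst σL (subst (CobordantGame.cruxChart k w c) F) =
      subst σR (subst (CobordantGame.cruxChart k w c) F) := by
    rw [subst_comp_subst_apply hc hL, subst_comp_subst_apply hc hR]
    congr 1
    funext i
    exact hagree i
  rw [h, subst_mul hL, subst_mul hR, subst_pow hL, subst_pow hR, subst_X hL, subst_X hR, hu, mul_pow,
    mul_assoc] at e1
  -- `e1 : σL 0 ^ a * subst σL g = u ^ a * (σL 0 ^ a * subst σR g)`
  have e2 : σL 0 ^ a * (subst σL g - u ^ a * subst σR g) = 0 := by
    rw [mul_sub, e1]; ring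
  rcases mul_eq_zero.mp e2 with h' | h'
  · exact absurd h' (pow_ne_zero a h0)
  · exact sub_eq_zero.mp h'

/-- `X 0 ≠ 0` in `k[[X₀, …]]`. [OURS · L1 W4.3] -/
theorem X_zero_ne_zero {m : ℕ} : (X (0 : Fin (m + 1)) : MvPowerSeries (Fin (m + 1)) k) ≠ 0 :=
  nonZeroDivisors.ne_zero X_mem_nonzeroDivisors

/-! ## A1 = B1: orbit quasi-invariance -/

/-- The two orbit families agree on the chart: `s^{wᵢ}(cᵢ + (λ^{wᵢ}(cᵢ+yᵢ) − cᵢ)) = (λ s)^{wᵢ}(cᵢ + yᵢ)`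
(and `yᵢ = yᵢ` when `wᵢ = 0`). [OURS · L1 W4.3] -/
theorem subst_orbitL_cruxChart {n : ℕ} (w : Fin n → ℕ) (c : Fin n → k) (i : Fin n) :
    subst (orbitL w c) (CobordantGame.cruxChart k w c i) = subst orbitR (CobordantGame.cruxChart k w c i) := by
  have hL := hasSubst_orbitL (k := k) w c
  have hR := hasSubst_orbitR (k := k) (n := n)
  unfold CobordantGame.cruxChart
  by_cases h : 0 < w i
  · rw [if_pos h]
    rw [subst_mul hL, subst_mul hR, subst_pow hL, subst_pow hR, subst_add hL, subst_add hR,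
      subst_C, subst_C, subst_X hL, subst_X hR, subst_X hL, subst_X hR]
    simp only [orbitL, orbitR, Matrix.cons_val_zero, Matrix.cons_val_succ]
    rw [mul_pow]
    ring
  · rw [if_neg h, subst_X hL, subst_X hR]
    have hw : w i = 0 := by omega
    simp only [orbitL, orbitR, Matrix.cons_val_succ, hw, pow_zero, one_mul]
    ring

/-- A1 = B1 — ORBIT QUASI-INVARIANCE (elementary; quasi-homogeneity bookkeeping of the strict transform on `B`, no
inverses of `λ` needed in the statement).  If `F(chart_c) = sᵃ · g` then `g(s, λ^w(c+y) − c) = λᵃ · g(λ s, y)` with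
`λ = 1 + μ`. [OURS · L1 W4.3, Sketch-L1-idea-1 v3 §1 — signature verbatim] -/
theorem orbit_quasi_invariance {n : ℕ} (F : MvPowerSeries (Fin n) k) (w : Fin n → ℕ) (c : Fin n → k) (a : ℕ)
    (g : MvPowerSeries (Fin (n + 1)) k)
    (h : subst (CobordantGame.cruxChart k w c) F = X (0 : Fin (n + 1)) ^ a * g) :
    subst (orbitL w c) g = (1 + X (Fin.last (n + 1))) ^ a * subst orbitR g :=
  subst_eq_mul_subst_of_chart_factor w c (hasSubst_orbitL w c) hasSubst_orbitR (1 + X (Fin.last (n + 1)))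
    (by simp [orbitL, orbitR]) (by simpa [orbitL] using X_zero_ne_zero) (subst_orbitL_cruxChart w c) F a g h

/-! ## R3-T1: the slice pull-back -/

/-- The two slice families agree on the chart (the frozen coordinate: `s^{w}(c + c((1+μ)^{w} − 1)) = ((1+μ)s)^{w}·c`).
[OURS · L1 W4.3] -/
theorem subst_sliceL_cruxChart {n : ℕ} (w : Fin n → ℕ) (c : Fin n → k) (i₀ : Fin n) (i : Fin n) :
    subst (sliceL w c i₀) (CobordantGame.cruxChart k w c i) = subst (sliceR i₀) (CobordantGame.cruxChart k w c i) := by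
  have hL := hasSubst_sliceL (k := k) w c i₀
  have hR := hasSubst_sliceR (k := k) i₀
  unfold CobordantGame.cruxChart
  by_cases h : 0 < w i
  · rw [if_pos h]
    rw [subst_mul hL, subst_mul hR, subst_pow hL, subst_pow hR, subst_add hL, subst_add hR,
      subst_C, subst_C, subst_X hL, subst_X hR, subst_X hL, subst_X hR]
    by_cases hi : i = i₀
    · subst hi
      simp only [sliceL, sliceR, Matrix.cons_val_zero, Matrix.cons_val_succ, if_true]
      rw [mul_pow]
      ring
    · simp only [sliceL, sliceR, Matrix.cons_val_zero, Matrix.cons_val_succ, hi, if_false]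
      rw [mul_pow]
      ring
  · rw [if_neg h, subst_X hL, subst_X hR]
    have hw : w i = 0 := by omega
    by_cases hi : i = i₀
    · subst hi
      simp only [sliceL, sliceR, Matrix.cons_val_succ, if_true, hw, pow_zero, one_mul]
      ring
    · simp only [sliceL, sliceR, Matrix.cons_val_succ, hi, if_false, hw, pow_zero, one_mul]
      ring

/-- R3-T1 — SLICE PULL-BACK (class level; corollary of the orbit computation by freezing `y_{i₀}`).  Along the
re-parametrised orbit through the slice point, `g` is a unit times the cylinder over its slice restriction
`h = g|_{y_{i₀}=0}`: `g(s, sliceL) = (1+μ)ᵃ · h((1+μ)s, y_{≠i₀})`. [OURS · L1 W4.3, Sketch-L1-idea-1 v3 §5 —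
signature verbatim] -/
theorem wildSlice_pullback {n : ℕ} (F : MvPowerSeries (Fin n) k) (w : Fin n → ℕ) (c : Fin n → k) (a : ℕ)
    (g : MvPowerSeries (Fin (n + 1)) k) (i₀ : Fin n)
    (h : subst (CobordantGame.cruxChart k w c) F = X (0 : Fin (n + 1)) ^ a * g) :
    subst (sliceL w c i₀) g = (1 + X (Fin.last (n + 1))) ^ a * subst (sliceR i₀) g :=
  subst_eq_mul_subst_of_chart_factor w c (hasSubst_sliceL w c i₀) (hasSubst_sliceR i₀) (1 + X (Fin.last (n + 1)))
    (by simp [sliceL, sliceR]) (by simpa [sliceL] using X_zero_ne_zero) (subst_sliceL_cruxChart w c i₀) F a g h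

end GradedGame

end Summit.ResolutionOfSingularities.ResolutionOfSingularities.Theorems
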